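import Mathlib
import Summits.ValiantsHypothesis.ValiantsHypothesis.Theses.ValuativeGCT

/-!
# `CutBites` — negative lemma: `3 ≤ m` IS LOAD-BEARING (the crux without it fails at `m = 1`)

Crux `stmt-ValiantsHypothesis-12626` (`Theses.ValuativeGCT.CutBites`, route ValuativeGCT).  Standing
disprover (cdisprove gen 2), `Cruxes/CutBites/Disproof.lean` §A, restated over the crux's literal
`let`-blocks.

* `cutBites_trunc_eq_at_one` — at `m = 1` the skew space is `0`, `L_Λ = {{0}}`, its vanishing ideal is
  the irrelevant ideal `𝔪`, and `Hom_δ ⊆ 𝔪^δ`; so the crux's truncation has `T δ = T 0` for every `δ`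
  and every weight: no cut ever.
* `cutBites_false_without_three_le` — hence the crux with the hypothesis `3 ≤ m` deleted is FALSE
  (the odd number `m = 1`): any proof of `CutBites` must use `3 ≤ m` (in fact `m ≠ 1`).
[folklore]
-/

namespace Summit.ValiantsHypothesis.ValiantsHypothesis.Theorems.CutBites.Negative

open Literature.NumberTheory.DiophantineGeometry Literature.Computability.AlgebraicComplexity
open MvPolynomial
open scoped BigOperators Matrix

noncomputable section

/-- `Λ_1 = 0`: a `1 × 1` skew matrix vanishes. [folklore] -/
theorem span_skew_one_eq_bot : Submodule.span ℂ {u : MatIdx 1 → ℂ | ∀ a b : Fin 1, u (toLex (a, b)) = -u (toLex (b, a))} = ⊥ := by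
  rw [Submodule.span_eq_bot]
  intro u hu
  funext i
  have h := hu 0 0
  have hi : i = toLex ((0 : Fin 1), (0 : Fin 1)) :=
    congrArg toLex (Subsingleton.elim (ofLex i) ((0 : Fin 1), (0 : Fin 1)))
  rw [hi]
  have h0 : u (toLex ((0 : Fin 1), (0 : Fin 1))) = 0 := by linear_combination h / 2
  simpa using h0

/-- At `m = 1` every coordinate function vanishes on `L_Λ = {0}`. [folklore] -/
theorem X_mem_vanishingIdeal_one (v : MatIdx 1 × MatIdx 1) :
    (X v : MvPolynomial (MatIdx 1 × MatIdx 1) ℂ) ∈ MvPolynomial.vanishingIdeal ℂ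
      {p : MatIdx 1 × MatIdx 1 → ℂ | ∀ j : MatIdx 1, (fun i => p (j, i)) ∈ Submodule.span ℂ {u : MatIdx 1 → ℂ | ∀ a b : Fin 1, u (toLex (a, b)) = -u (toLex (b, a))}} := by
  rw [mem_vanishingIdeal_iff]
  intro p hp
  have h := hp v.1
  rw [span_skew_one_eq_bot, Submodule.mem_bot] at h
  have : p (v.1, v.2) = 0 := by simpa using congr_fun h v.2
  simpa using this

/-- At `m = 1`, `Hom_D ⊆ P_Λ^D`. [folklore] -/
theorem homogeneousSubmodule_le_vanishingIdeal_pow_one (D : ℕ) :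
    MvPolynomial.homogeneousSubmodule (MatIdx 1 × MatIdx 1) ℂ D ≤ ((MvPolynomial.vanishingIdeal ℂ
      {p : MatIdx 1 × MatIdx 1 → ℂ | ∀ j : MatIdx 1, (fun i => p (j, i)) ∈ Submodule.span ℂ {u : MatIdx 1 → ℂ | ∀ a b : Fin 1, u (toLex (a, b)) = -u (toLex (b, a))}})
        ^ D).restrictScalars ℂ := by
  intro φ hφ
  rw [Submodule.restrictScalars_mem, φ.as_sum]
  refine Ideal.sum_mem _ fun d hd => ?_
  rw [MvPolynomial.monomial_eq]
  refine Ideal.mul_mem_left _ _ ?_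
  have hdeg : (∑ i ∈ d.support, d i) = D := by
    have := hφ (mem_support_iff.mp hd)
    simpa [Finsupp.weight_apply, Finsupp.sum] using this
  rw [Finsupp.prod, ← hdeg, ← Finset.prod_pow_eq_pow_sum]
  exact Ideal.prod_mem_prod fun i _ => Ideal.pow_mem_pow (X_mem_vanishingIdeal_one i) _

/-- Lattice bookkeeping: if `Hom ≤ P^t` then thresholds `t` and `0` agree. [folklore] -/
theorem inf_pow_eq_inf_pow_zero_of_le {σ : Type*} (Hom S W : Submodule ℂ (MvPolynomial σ ℂ))
    (P : Ideal (MvPolynomial σ ℂ)) (t : ℕ) (h : Hom ≤ (P ^ t).restrictScalars ℂ) :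
    Hom ⊓ (P ^ t).restrictScalars ℂ ⊓ S ⊓ W = Hom ⊓ (P ^ 0).restrictScalars ℂ ⊓ S ⊓ W := by
  rw [inf_eq_left.mpr h, pow_zero, Ideal.one_eq_top, Submodule.restrictScalars_top, inf_top_eq]

/-- **No cut at `m = 1`**: the crux's truncation (verbatim, `m = 1`) has `T δ = T 0` for every `δ`
and every `λ`. [folklore] -/
theorem cutBites_trunc_eq_at_one (δ : ℕ) (lam : Nat.Partition (1 * δ)) :
    (let U : Submodule ℂ (MatIdx 1 → ℂ) :=
        Submodule.span ℂ {u : MatIdx 1 → ℂ | ∀ a b : Fin 1, u (toLex (a, b)) = -u (toLex (b, a))};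
      let χ : Weight (MatIdx 1) := (Weight.dualOfPartition (1 * 1) lam).toMatIdx;
      let T : ℕ → Submodule ℂ (MvPolynomial (MatIdx 1 × MatIdx 1) ℂ) := fun t =>
        MvPolynomial.homogeneousSubmodule (MatIdx 1 × MatIdx 1) ℂ (1 * δ)
        ⊓ ((MvPolynomial.vanishingIdeal ℂ {p : MatIdx 1 × MatIdx 1 → ℂ |
              ∀ j : MatIdx 1, (fun i => p (j, i)) ∈ U}) ^ (t)).restrictScalars ℂ
        ⊓ (⨅ (M : Matrix (MatIdx 1) (MatIdx 1) ℂ)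
            (_ : linSubst (MatIdx 1) ℂ M (detFormLex ℂ 1) = detFormLex ℂ 1),
            LinearMap.ker ((MvPolynomial.aeval (R := ℂ) fun p : MatIdx 1 × MatIdx 1 =>
              ∑ l : MatIdx 1, M l p.2 • MvPolynomial.X (p.1, l)).toLinearMap
              - LinearMap.id (R := ℂ) (M := MvPolynomial (MatIdx 1 × MatIdx 1) ℂ)))
        ⊓ (⨅ (g : Matrix.GeneralLinearGroup (MatIdx 1) ℂ) (_ : IsUpperTriangular g),
            LinearMap.ker ((MvPolynomial.aeval (R := ℂ) fun p : MatIdx 1 × MatIdx 1 =>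
              ∑ l : MatIdx 1, ((g⁻¹ : Matrix.GeneralLinearGroup (MatIdx 1) ℂ) :
                Matrix (MatIdx 1) (MatIdx 1) ℂ) p.1 l • MvPolynomial.X (l, p.2)).toLinearMap
              - weightChar χ g • LinearMap.id (R := ℂ) (M := MvPolynomial (MatIdx 1 × MatIdx 1) ℂ)));
      T δ = T 0) := by
  intro U χ T
  exact inf_pow_eq_inf_pow_zero_of_le _ _ _ _ δ
    ((one_mul δ).symm ▸ homogeneousSubmodule_le_vanishingIdeal_pow_one δ)

/-- At `m = 1` no `(δ, λ)` is a witness: the two `finrank`s agree. [folklore] -/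
theorem cutBites_not_lt_at_one (δ : ℕ) (lam : Nat.Partition (1 * δ)) :
    (let U : Submodule ℂ (MatIdx 1 → ℂ) :=
        Submodule.span ℂ {u : MatIdx 1 → ℂ | ∀ a b : Fin 1, u (toLex (a, b)) = -u (toLex (b, a))};
      let χ : Weight (MatIdx 1) := (Weight.dualOfPartition (1 * 1) lam).toMatIdx;
      let T : ℕ → Submodule ℂ (MvPolynomial (MatIdx 1 × MatIdx 1) ℂ) := fun t =>
        MvPolynomial.homogeneousSubmodule (MatIdx 1 × MatIdx 1) ℂ (1 * δ)
        ⊓ ((MvPolynomial.vanishingIdeal ℂ {p : MatIdx 1 × MatIdx 1 → ℂ |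
              ∀ j : MatIdx 1, (fun i => p (j, i)) ∈ U}) ^ (t)).restrictScalars ℂ
        ⊓ (⨅ (M : Matrix (MatIdx 1) (MatIdx 1) ℂ)
            (_ : linSubst (MatIdx 1) ℂ M (detFormLex ℂ 1) = detFormLex ℂ 1),
            LinearMap.ker ((MvPolynomial.aeval (R := ℂ) fun p : MatIdx 1 × MatIdx 1 =>
              ∑ l : MatIdx 1, M l p.2 • MvPolynomial.X (p.1, l)).toLinearMap
              - LinearMap.id (R := ℂ) (M := MvPolynomial (MatIdx 1 × MatIdx 1) ℂ)))
        ⊓ (⨅ (g : Matrix.GeneralLinearGroup (MatIdx 1) ℂ) (_ : IsUpperTriangular g),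
            LinearMap.ker ((MvPolynomial.aeval (R := ℂ) fun p : MatIdx 1 × MatIdx 1 =>
              ∑ l : MatIdx 1, ((g⁻¹ : Matrix.GeneralLinearGroup (MatIdx 1) ℂ) :
                Matrix (MatIdx 1) (MatIdx 1) ℂ) p.1 l • MvPolynomial.X (l, p.2)).toLinearMap
              - weightChar χ g • LinearMap.id (R := ℂ) (M := MvPolynomial (MatIdx 1 × MatIdx 1) ℂ)));
      ¬ (Module.finrank ℂ ↥(T δ) < Module.finrank ℂ ↥(T 0))) := by
  intro U χ T
  have key : T δ = T 0 := cutBites_trunc_eq_at_one δ lam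
  rw [key]
  exact lt_irrefl _

/-- **`3 ≤ m` is load-bearing.**  The crux `CutBites` with its hypothesis `3 ≤ m` deleted is FALSE:
at the odd number `m = 1` no `(δ, λ)` is cut. [folklore] -/
theorem cutBites_false_without_three_le :
    ¬ (∀ m : ℕ, Odd m → ∃ (δ : ℕ) (lam : Nat.Partition (m * δ)), lam.parts.card ≤ m * m ∧
      (let U : Submodule ℂ (MatIdx m → ℂ) :=
        Submodule.span ℂ {u : MatIdx m → ℂ | ∀ a b : Fin m, u (toLex (a, b)) = -u (toLex (b, a))};
      let χ : Weight (MatIdx m) := (Weight.dualOfPartition (m * m) lam).toMatIdx;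
      let T : ℕ → Submodule ℂ (MvPolynomial (MatIdx m × MatIdx m) ℂ) := fun t =>
        MvPolynomial.homogeneousSubmodule (MatIdx m × MatIdx m) ℂ (m * δ)
        ⊓ ((MvPolynomial.vanishingIdeal ℂ {p : MatIdx m × MatIdx m → ℂ |
              ∀ j : MatIdx m, (fun i => p (j, i)) ∈ U}) ^ (t)).restrictScalars ℂ
        ⊓ (⨅ (M : Matrix (MatIdx m) (MatIdx m) ℂ)
            (_ : linSubst (MatIdx m) ℂ M (detFormLex ℂ m) = detFormLex ℂ m),
            LinearMap.ker ((MvPolynomial.aeval (R := ℂ) fun p : MatIdx m × MatIdx m =>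
              ∑ l : MatIdx m, M l p.2 • MvPolynomial.X (p.1, l)).toLinearMap
              - LinearMap.id (R := ℂ) (M := MvPolynomial (MatIdx m × MatIdx m) ℂ)))
        ⊓ (⨅ (g : Matrix.GeneralLinearGroup (MatIdx m) ℂ) (_ : IsUpperTriangular g),
            LinearMap.ker ((MvPolynomial.aeval (R := ℂ) fun p : MatIdx m × MatIdx m =>
              ∑ l : MatIdx m, ((g⁻¹ : Matrix.GeneralLinearGroup (MatIdx m) ℂ) :
                Matrix (MatIdx m) (MatIdx m) ℂ) p.1 l • MvPolynomial.X (l, p.2)).toLinearMap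
              - weightChar χ g • LinearMap.id (R := ℂ) (M := MvPolynomial (MatIdx m × MatIdx m) ℂ)));
      Module.finrank ℂ ↥(T δ) < Module.finrank ℂ ↥(T 0))) := by
  intro h
  obtain ⟨δ, lam, -, hlt⟩ := h 1 odd_one
  exact cutBites_not_lt_at_one δ lam hlt

end

end Summit.ValiantsHypothesis.ValiantsHypothesis.Theorems.CutBites.Negative
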